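import Summits.CriticalPhenomena.PercolationContinuityZ3.Theorems.Transplant.SqShadowLemma4
import Summits.CriticalPhenomena.PercolationContinuityZ3.Theorems.Transplant.HexShadowGluing
import HarnessLib

/-!
# SQUARE SHADOWS IX — the node of record: DST's GLUING LEMMA 6 in square geometry (`SqShadow.SqGluing`), and eqs. (10)–(12):
# **eq. (12) for `p < 1` from the Gluing Lemma alone**

builds on p205010 (kernel theorem, internal audit signed; external expert review pending) — NOT used in this file.
Lane `prim-bschramm`, seat `prim-bschramm-p2` (gen 42; class C1b; memo `HOME/bschramm/P2-LATTICES.md` §148); helper file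
(`--supports stmt-CriticalPhenomena-4575 --as helper`).  Hexagonal twin «HexShadowGluing» (whose generic `HexShadow.lemma5_linear` and `HexShadow.real_inter_three_ge` are
reused); slab originals `DuminilCopinSidoraviciusTassion2016_lemma6'` (`SlabCriticalityChain4`), `…_lemma5`, `…_eq12_of_lemmas` (`SlabCriticality`).

THE GEOMETRY (scale `n`; `c` = centre, `P` = period) — DST's own.  `H₃ = sqBall c 3n` (`B_{3n}`), `S₃ = sqBall c u₃` (`4u₃ ≤ 3n`, so `S₃` does not touch `B'`), the
auxiliary square `B' = sqBall c' n`, `c' = glueCentre n s = c + (2n, P·s)` (DST's `(2n, y) + B_n`; a point of the symmetry lattice `c + P•ℤ²` when `P ∣ n`), whose right side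
lies on the right side line `{w₀ = c₀ + 3n}` of `H₃`; `S' = sqBall c' u₁` (`4u₁ ≤ n`); on that side, in `B'`-midpoint coordinates `x ∈ [−n, n]`: the landing zone
`Z = sqSide c' n (−a) a` and `Y⁻ = sqSide c' n (−n) (−a)`, `Y⁺ = sqSide c' n a n` (`1 ≤ a ≤ n − 1`).  Events `A = S₃ ⟷^{H₃} Z`, `B∓ = S' ⟷^{B'} Y∓`, `C = S₃ ⟷^{H₃ ∪ B'} S'`.
* §1 the vocabulary and **the node `SqShadow.SqGluing`**: for `θ_v(p) > 0`, `p < 1`: `∀ ε > 0 ∃ δ > 0 ∃ n₀ ∀ n ≥ n₀ (P ∣ n) ∀` data in range,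
  `P_p[A ∩ B⁻ ∩ B⁺] ≥ 1 − δ ⇒ P_p[C] ≥ 1 − ε` — DST's Lemma 6 verbatim, in the non-touching range and for large scales only.  An internal obligation, never asserted: it is
  what §2.3 of the paper (multi-valued map principle, `γ_min`, `U(ω)`, Facts 1–2 with a local-surgery hypothesis on the instance) proves.
* §2 **`eq12_of_sqGluing_lt_one`**: for `p < 1`, `θ_v(p) > 0`, `u` with `4u_n ≤ n` and eq. (1), the Gluing Lemma gives DST's eq. (12): Lemma 4 («SqShadowLemma4») at scales `n` and
  `3n` (`n ∈ P•ℕ` by Lemma 5), the landing interval `[a_{3n}, b_{3n}]` of length `≤ 2α_n` inside `Z` of half-width `a = α_n + P` centred at the lattice point `c'` nearest below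
  the midpoint (the SLACK of «SqShadowLemma4» pays for the rounding), `P[B±] = P[E_n(α_n + P, n)]` by translation and the flip, Harris twice (eq. (11)), the node,
  `H₃ ∪ B' ⊆ sqBall c 4n`.
[cite: DuminilCopinSidoraviciusTassion2016, §2.1 Lemma 5, Lemma 6, eqs. (10)–(12)] [cite: GrimmettPercolation1999, Thm. 2.4 and §1.6 p. 16]
-/

noncomputable section

namespace Summit.CriticalPhenomena.PercolationContinuityZ3.Theorems.Transplant

open MeasureTheory Literature.Probability.Percolation Literature.Probability.LatticeModels SimpleGraph Filter
open scoped Classical Topology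

namespace SqShadow

variable {V : Type} {G : SimpleGraph V} (Ψ : SqShadow G)

/-! ## §1 The two-square configuration and the node -/

/-- The centre `c' = c + (2n, period·s)` of the auxiliary square `B' = sqBall c' n` at scale `n` with side offset `s` (a point of the symmetry lattice `c + period•ℤ²` when
`period ∣ n`). [cite: DuminilCopinSidoraviciusTassion2016, §2.1 (B'_n = (2n, y) + B_n)] -/
def glueCentre (n : ℕ) (s : ℤ) : Site 2 := Ψ.centre + ![2 * (n : ℤ), (Ψ.period : ℤ) * s]

/-- **`A = S₃ ⟷^{H₃} Z`**: the inner square `sqBall c u₃` is joined inside `sqBall c 3n` to the landing zone `Z = sqSide c' n (−a) a` (the middle of the right side of `B'`, on the right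
side line `{w₀ = c₀ + 3n}` of `sqBall c 3n`). [cite: DuminilCopinSidoraviciusTassion2016, §2.1 (S_{3n} ⟷^{B_{3n}} Z_n)] -/
def glueA (n u₃ a : ℕ) (s : ℤ) : Set (BondConfig V) := Ψ.conn (sqBall Ψ.centre (3 * n)) (sqBall Ψ.centre u₃) (sqSide (Ψ.glueCentre n s) n (-(a : ℤ)) a)

/-- **`B⁻ = S' ⟷^{B'} Y⁻`**, `Y⁻ = sqSide c' n (−n) (−a)`. [cite: DuminilCopinSidoraviciusTassion2016, §2.1 (S'_n ⟷^{B'_n} Y_n^-)] -/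
def glueBm (n u₁ a : ℕ) (s : ℤ) : Set (BondConfig V) := Ψ.sideEvent (Ψ.glueCentre n s) n u₁ (-(n : ℤ)) (-(a : ℤ))

/-- **`B⁺ = S' ⟷^{B'} Y⁺`**, `Y⁺ = sqSide c' n a n`. [cite: DuminilCopinSidoraviciusTassion2016, §2.1 (S'_n ⟷^{B'_n} Y_n^+)] -/
def glueBp (n u₁ a : ℕ) (s : ℤ) : Set (BondConfig V) := Ψ.sideEvent (Ψ.glueCentre n s) n u₁ a n

/-- **`C = S₃ ⟷^{H₃ ∪ B'} S'`**: the glued connection. [cite: DuminilCopinSidoraviciusTassion2016, Lemma 6 (S_{3n} ⟷^{B_{3n} ∪ B'_n} S'_n)] -/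
def glueC (n u₃ u₁ : ℕ) (s : ℤ) : Set (BondConfig V) :=
  Ψ.conn (sqBall Ψ.centre (3 * n) ∪ sqBall (Ψ.glueCentre n s) n) (sqBall Ψ.centre u₃) (sqBall (Ψ.glueCentre n s) u₁)

/-- **THE NODE — DST's GLUING LEMMA 6 in square geometry, for an abstract square shadow.**  For `θ_v(p) > 0` and `p < 1`: for every `ε > 0` there are `δ > 0` and a scale `n₀`
such that for all scales `n ≥ n₀` divisible by the period and all data in range — inner radii `4u₃ ≤ 3n` (NO touching of `S₃` and `B'`), `4u₁ ≤ n`, landing half-width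
`1 ≤ a ≤ n − 1`, side offset `period·s ∈ [0, 3n]` (the other sign is the mirror image) —, `P_p[A ∩ B⁻ ∩ B⁺] ≥ 1 − δ` implies `P_p[C] ≥ 1 − ε`.  ("Projections of paths from `S̄₃` to `Z̄` and from `S̄'` to `Ȳ⁻`, `Ȳ⁺`
must intersect, but the paths themselves have no reason to do so"; proved in §2.3 of the paper from the multi-valued map principle — `γ_min`, `U(ω)`, Fact 1 (closing the columns
of `U`), Fact 2 (a local surgery, for which the instance must supply three disjoint paths in a column block).)  An internal obligation, never asserted.
[cite: DuminilCopinSidoraviciusTassion2016, Lemma 6 and §2.3] -/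
def SqGluing {V : Type} {G : SimpleGraph V} (Ψ : SqShadow G) [Countable V] : Prop :=
  ∀ (v : V) (p : unitInterval), 0 < theta G v p → (p : ℝ) < 1 → ∀ ε : ℝ, 0 < ε → ∃ δ : ℝ, 0 < δ ∧ ∃ n₀ : ℕ,
    ∀ (n u₃ u₁ a : ℕ) (s : ℤ), n₀ ≤ n → Ψ.period ∣ n → 4 * u₃ ≤ 3 * n → 4 * u₁ ≤ n → 1 ≤ a → a + 1 ≤ n →
      0 ≤ (Ψ.period : ℤ) * s → (Ψ.period : ℤ) * s ≤ 3 * n →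
      1 - δ ≤ (bondPercolation G p).real (Ψ.glueA n u₃ a s ∩ Ψ.glueBm n u₁ a s ∩ Ψ.glueBp n u₁ a s) →
      1 - ε ≤ (bondPercolation G p).real (Ψ.glueC n u₃ u₁ s)

/-! ## §2 Eq. (12) for `p < 1` from the Gluing Lemma -/

/-- The side offset geometry: `glueCentre n s = c + period • (2j, s)` when `n = period·j`. [folklore] -/
theorem glueCentre_eq_shift {n j : ℕ} (hn : n = Ψ.period * j) (s : ℤ) : Ψ.glueCentre n s = Ψ.centre + (Ψ.period : ℤ) • (![2 * (j : ℤ), s] : Site 2) := by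
  unfold glueCentre
  congr 1
  ext i; fin_cases i
  · simp [hn]; ring
  · simp

/-- `glueCentre n s` in the coordinates of `Eq12Likely4`: `c + (2n)•e₀ + (period·s)•e₁`. [folklore] -/
theorem glueCentre_eq_single (n : ℕ) (s : ℤ) :
    Ψ.glueCentre n s = Ψ.centre + (2 * (n : ℤ)) • (Pi.single 0 1 : Site 2) + ((Ψ.period : ℤ) * s) • (Pi.single 1 1 : Site 2) := by
  unfold glueCentre
  rw [add_assoc]
  congr 1
  ext i; fin_cases i
  · simp
  · simp

/-- Coordinates of `glueCentre`. [folklore] -/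
theorem glueCentre_apply (n : ℕ) (s : ℤ) : Ψ.glueCentre n s 0 = Ψ.centre 0 + 2 * n ∧ Ψ.glueCentre n s 1 = Ψ.centre 1 + Ψ.period * s := by
  unfold glueCentre; simp

/-- **`H₃ ∪ B' ⊆ sqBall c 4n`** for side offsets `period·s ∈ [−3n, 3n]`. [folklore] -/
theorem glueRegion_subset (n : ℕ) {s : ℤ} (hs1 : -(3 * (n : ℤ)) ≤ Ψ.period * s) (hs2 : (Ψ.period : ℤ) * s ≤ 3 * n) :
    sqBall Ψ.centre (3 * n) ∪ sqBall (Ψ.glueCentre n s) n ⊆ sqBall Ψ.centre (4 * n) := by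
  rintro w (hw | hw)
  · exact sqBall_mono _ (by omega) hw
  · rw [mem_sqBall_iff_linear] at hw ⊢
    have h := Ψ.glueCentre_apply n s
    rw [h.1, h.2] at hw
    push_cast at hw ⊢
    omega

/-- **The landing interval sits inside the landing zone** (eq. (10)): with `[a₃, b₃]` of length `≤ 2α` (Lemma 4 at scale `3n`, Lemma 5), `y = ⌊(a₃+b₃)/2⌋`,
`period·s ≤ y < period·s + period` and half-width `a = α + period`: `sqSide c (3n) a₃ b₃ ⊆ sqSide c' n (−a) a`. [cite: DuminilCopinSidoraviciusTassion2016, §2.1 eq. (10)] -/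
theorem sqSide_subset_landingZone {n α a₃ b₃ : ℕ} {s : ℤ} (hab : a₃ ≤ b₃) (hlen : b₃ - a₃ ≤ 2 * α)
    (hs1 : (Ψ.period : ℤ) * s ≤ ((a₃ + b₃) / 2 : ℕ)) (hs2 : (((a₃ + b₃) / 2 : ℕ) : ℤ) < Ψ.period * s + Ψ.period) :
    sqSide Ψ.centre (3 * n) a₃ b₃ ⊆ sqSide (Ψ.glueCentre n s) n (-((α + Ψ.period : ℕ) : ℤ)) ((α + Ψ.period : ℕ) : ℤ) := by
  rintro w ⟨h0, h1, h2⟩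
  have hy1 : 2 * ((a₃ + b₃) / 2) ≤ a₃ + b₃ := Nat.mul_div_le _ _
  have hy2 : a₃ + b₃ < 2 * ((a₃ + b₃) / 2) + 2 := by omega
  have h := Ψ.glueCentre_apply n s
  simp only [mem_sqSide, h.1, h.2]
  push_cast at h0 h1 h2 hs1 hs2 ⊢
  generalize (Ψ.period : ℤ) * s = t at hs1 hs2 ⊢
  refine ⟨by linarith, ?_, ?_⟩ <;> omega

/-- **EQ. (12) FOR `p < 1` FROM THE GLUING LEMMA** (DST §2.1, eqs. (10)–(12), square geometry; conclusion in the form of `Eq12Likely4`).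
[cite: DuminilCopinSidoraviciusTassion2016, §2.1 eqs. (10)–(12)] -/
theorem eq12_of_sqGluing_lt_one [Countable V] (h6 : Ψ.SqGluing) {v : V} {p : unitInterval} (hθ : 0 < theta G v p) (hp : (p : ℝ) < 1)
    {u : ℕ → ℕ} (hu4 : ∀ n, 4 * u n ≤ n)
    (hlim : Tendsto (fun n => (bondPercolation G p).real (Ψ.uniqueConn (sqBall Ψ.centre n) (sqBall Ψ.centre (u n)) (sqRing Ψ.centre n))) atTop (𝓝 1))
    (ε : ℝ) (hε : 0 < ε) (N : ℕ) :
    ∃ n : ℕ, N ≤ n ∧ Ψ.period ∣ n ∧ ∃ s : ℤ, -(3 * (n : ℤ)) ≤ Ψ.period * s ∧ (Ψ.period : ℤ) * s ≤ 3 * n ∧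
      1 - ε < (bondPercolation G p).real (Ψ.conn (sqBall Ψ.centre (4 * n)) (sqBall Ψ.centre (u (3 * n)))
        (sqBall (Ψ.centre + (2 * (n : ℤ)) • Pi.single 0 1 + ((Ψ.period : ℤ) * s) • Pi.single 1 1) (u n))) := by
  set c := Ψ.centre with hc
  set P := bondPercolation G p with hP
  set Pd : ℕ := Ψ.period with hPd
  have hPd1 : 1 ≤ Pd := Ψ.period_pos
  -- inner radii `u m < m`
  have hv : ∀ m, 1 ≤ m → u m < m := fun m hm => by have := hu4 m; omega
  -- Lemma 4's input
  have hD : Tendsto (fun m => P.real (Ψ.conn (sqBall c m) (sqBall c (u m)) (sqRing c m))) atTop (𝓝 1) := by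
    refine tendsto_of_tendsto_of_tendsto_of_le_of_le' hlim tendsto_const_nhds (Filter.Eventually.of_forall fun m => ?_)
      (Filter.Eventually.of_forall fun m => measureReal_le_one)
    exact measureReal_mono (Ψ.uniqueConn_subset_conn _ _ _)
  -- Lemma 4 and the slack
  obtain ⟨α, a, b, hαab, hevα, hT1, hT2⟩ := Ψ.lemma4 p hp u hv hD
  have hTk := Ψ.tendsto_real_sideEvent_add p hp u hv hT1 Pd
  have hevk := Ψ.eventually_lt_of_tendsto_sideEvent p hp u hv hTk
  -- the node at `ε/2`
  obtain ⟨δ, hδ, n₀, hnode⟩ := h6 v p hθ hp (ε / 2) (by positivity)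
  have hδ3 : 0 < δ / 3 := by positivity
  have hev1 : ∀ᶠ m in atTop, P.real (Ψ.sideEvent c m (u m) ((α m + Pd : ℕ) : ℤ) m) ∈ Set.Ioi (1 - δ / 3) :=
    hTk.eventually (Ioi_mem_nhds (show (1 : ℝ) - δ / 3 < 1 by linarith))
  have hev2 : ∀ᶠ m in atTop, P.real (Ψ.sideEvent c m (u m) (a m) (b m)) ∈ Set.Ioi (1 - δ / 3) :=
    hT2.eventually (Ioi_mem_nhds (show (1 : ℝ) - δ / 3 < 1 by linarith))
  obtain ⟨M, hM⟩ := Filter.eventually_atTop.1 (hev1.and (hev2.and hevk))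
  -- Lemma 5 along the multiples of the period
  obtain ⟨j, hj, hj1, hL5⟩ := HexShadow.lemma5_linear Pd (fun j => α (Pd * j)) (fun j hj => (hαab (Pd * j) (by nlinarith)).1)
    (fun j hj => (hαab (Pd * j) (by nlinarith)).2.1) (max (max n₀ M) (max N 1))
  set n : ℕ := Pd * j with hndef
  have hjn : j ≤ n := by rw [hndef]; nlinarith
  have hn₀ : n₀ ≤ n := ((le_max_left _ _).trans (le_max_left _ _)).trans (hj.trans hjn)
  have hMn : M ≤ n := ((le_max_right _ _).trans (le_max_left _ _)).trans (hj.trans hjn)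
  have hNn : N ≤ n := ((le_max_left _ _).trans (le_max_right _ _)).trans (hj.trans hjn)
  have hn1 : 1 ≤ n := ((le_max_right _ _).trans (le_max_right _ _)).trans (hj.trans hjn)
  have hPn : Pd ≤ n := by rw [hndef]; nlinarith
  have hdvd : Pd ∣ n := ⟨j, rfl⟩
  have hL5' : α (3 * n) ≤ 4 * α n := by rw [hndef, show 3 * (Pd * j) = Pd * (3 * j) by ring]; exact hL5
  obtain ⟨hM1, hM2, hMk⟩ := hM n hMn
  obtain ⟨-, hM3, -⟩ := hM (3 * n) (by omega)
  obtain ⟨hα1, hαn, habn, hbαn, hlenn⟩ := hαab n hn1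
  obtain ⟨hα13, hα3n, hab3, hbα3, hlen3⟩ := hαab (3 * n) (by omega)
  -- the data: round the midpoint of the landing interval down to the symmetry lattice
  have hPpos : (0 : ℤ) < Pd := by exact_mod_cast hPd1
  have hsr : ((((a (3 * n) + b (3 * n)) / 2 : ℕ)) : ℤ) % Pd + Pd * (((((a (3 * n) + b (3 * n)) / 2 : ℕ)) : ℤ) / Pd) =
      ((a (3 * n) + b (3 * n)) / 2 : ℕ) := Int.emod_add_mul_ediv _ _
  have hr0 : 0 ≤ ((((a (3 * n) + b (3 * n)) / 2 : ℕ)) : ℤ) % Pd := Int.emod_nonneg _ hPpos.ne'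
  have hr1 : ((((a (3 * n) + b (3 * n)) / 2 : ℕ)) : ℤ) % Pd < Pd := Int.emod_lt_of_pos _ hPpos
  obtain ⟨s, hsdef⟩ : ∃ s : ℤ, s = ((((a (3 * n) + b (3 * n)) / 2 : ℕ)) : ℤ) / Pd := ⟨_, rfl⟩
  rw [← hsdef] at hsr
  have hs1 : (Pd : ℤ) * s ≤ ((a (3 * n) + b (3 * n)) / 2 : ℕ) := by linarith
  have hs2 : (((a (3 * n) + b (3 * n)) / 2 : ℕ) : ℤ) < Pd * s + Pd := by linarith
  have hy3 : (a (3 * n) + b (3 * n)) / 2 ≤ 3 * n := by omega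
  have hy3' : ((((a (3 * n) + b (3 * n)) / 2 : ℕ)) : ℤ) ≤ 3 * (n : ℤ) := by exact_mod_cast hy3
  have hy0 : (0 : ℤ) ≤ (((a (3 * n) + b (3 * n)) / 2 : ℕ) : ℤ) := by positivity
  have hPn' : (Pd : ℤ) ≤ n := by exact_mod_cast hPn
  have hs0 : 0 ≤ s := by rw [hsdef]; exact Int.ediv_nonneg hy0 hPpos.le
  have hsr0 : 0 ≤ (Pd : ℤ) * s := by positivity
  have hsr1 : -(3 * (n : ℤ)) ≤ Pd * s := by linarith
  have hsr2 : (Pd : ℤ) * s ≤ 3 * n := by linarith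
  have hu₃r : 4 * u (3 * n) ≤ 3 * n := hu4 (3 * n)
  have hu₁r : 4 * u n ≤ n := hu4 n
  have haw1 : 1 ≤ α n + Pd := by omega
  have hawn : α n + Pd + 1 ≤ n := hMk
  refine ⟨n, hNn, hdvd, s, hsr1, hsr2, ?_⟩
  -- (10): `P[A] > 1 − δ/3`
  have hA : 1 - δ / 3 < P.real (Ψ.glueA n (u (3 * n)) (α n + Pd) s) := by
    refine lt_of_lt_of_le hM3 (measureReal_mono ?_)
    unfold glueA sideEvent
    exact Ψ.conn_mono subset_rfl subset_rfl (Ψ.sqSide_subset_landingZone hab3 (by omega) hs1 hs2)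
  -- `P[B⁺] = P[B⁻] = P[E_n(α_n + period, n)] > 1 − δ/3`
  have hshift : Ψ.glueCentre n s = c + (Ψ.period : ℤ) • (![2 * (j : ℤ), s] : Site 2) := Ψ.glueCentre_eq_shift rfl s
  have hBp : 1 - δ / 3 < P.real (Ψ.glueBp n (u n) (α n + Pd) s) := by
    unfold glueBp
    rw [hshift, hP, Ψ.real_sideEvent_shift]
    exact hM1
  have hBm : 1 - δ / 3 < P.real (Ψ.glueBm n (u n) (α n + Pd) s) := by
    unfold glueBm
    rw [hshift, hP, Ψ.real_sideEvent_shift, Ψ.real_sideEvent_flip]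
    exact hM1
  -- (11): Harris twice
  have htriple : 1 - δ ≤ P.real (Ψ.glueA n (u (3 * n)) (α n + Pd) s ∩ Ψ.glueBm n (u n) (α n + Pd) s ∩ Ψ.glueBp n (u n) (α n + Pd) s) :=
    HexShadow.real_inter_three_ge p (by unfold glueA; exact isUpperSet_openCrossing _ _ _) (by unfold glueBm; exact Ψ.isUpperSet_sideEvent _ _ _ _ _)
      (by unfold glueBp; exact Ψ.isUpperSet_sideEvent _ _ _ _ _) (by unfold glueA; exact Ψ.measurableSet_conn (sqBall_finite _ _) _ _)
      (by unfold glueBm; exact Ψ.measurableSet_sideEvent _ _ _ _ _) (by unfold glueBp; exact Ψ.measurableSet_sideEvent _ _ _ _ _) hδ hA hBm hBp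
  -- the Gluing Lemma
  have hC : 1 - ε / 2 ≤ P.real (Ψ.glueC n (u (3 * n)) (u n) s) := hnode n (u (3 * n)) (u n) (α n + Pd) s hn₀ hdvd hu₃r hu₁r haw1 hawn hsr0 hsr2 htriple
  -- (12): `H₃ ∪ B' ⊆ sqBall c 4n`
  have hmono : Ψ.glueC n (u (3 * n)) (u n) s ⊆ Ψ.conn (sqBall c (4 * n)) (sqBall c (u (3 * n)))
      (sqBall (c + (2 * (n : ℤ)) • Pi.single 0 1 + ((Pd : ℤ) * s) • Pi.single 1 1) (u n)) := by
    unfold glueC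
    refine Ψ.conn_mono (Ψ.glueRegion_subset n hsr1 hsr2) subset_rfl (subset_of_eq ?_)
    rw [← Ψ.glueCentre_eq_single n s]
  have hfin := measureReal_mono (μ := P) hmono
  linarith

end SqShadow

end Summit.CriticalPhenomena.PercolationContinuityZ3.Theorems.Transplant

end
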